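import Literature.NumberTheory.EllipticCurves.NeronOggShafarevichLocal
import HarnessLib

/-!
# Galois-trivial torsion stays Galois-trivial over every `K`-field: `E(K̄)[m] = E(K̄_{E'})[m]` — proofs

`Proofs` file (theorems only: no definition, no named fact, no instance), topic
`NumberTheory/EllipticCurves`, a corollary of `NeronOggShafarevichLocal`
(`exists_pointsMapOfEmb_eq_of_nsmul_eq_zero`: for `char K = 0` and `m ≠ 0` every `m`-torsion point
of `E(K̄_{E'})` is `ι_* P` for an `m`-torsion `P ∈ E(K̄)`, Silverman *AEC* Cor. III.6.4 (b)) and of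
the equivariance `ι_* (σ|_{K̄} • P) = σ • ι_* P` of `Sha.lean` (`pointsMapOfEmb_smul`): if the absolute
Galois group `Γ_K` fixes the `m`-torsion of `E(K̄)` pointwise, then for every `K`-field `E'`
(typically a completion `K_v`) the absolute Galois group `Γ_{E'}` fixes the `m`-torsion of
`E(K̄_{E'})` (`localPoints`, with its `Γ_{E'}`-action through `restrictScalars`) pointwise:

* `smul_eq_of_nsmul_eq_zero_of_forall_geomPoints` (through the chosen `K`-embedding `closureEmb E' : K̄ → K̄_{E'}` of `Sha.lean`);
* `smul_torsionBy_localPoints_eq` (the same on the subgroup `E(K̄_{E'})[m]`).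

Consumer (cell abc-iut; locator = WHERE it is used — the mathematics is classical): [IUTchI]
Example 3.2 (iv) p. 71, "`q_v̲` admits a `2l`-th root in `𝒪^▷_{K_v̲}` [from Def. 3.1 (b)(c)]": the
passage from the GLOBAL statement "`Γ_K` fixes `E_K[2l]`" (`InitialThetaDataTorsionProofs`) to the
LOCAL one at `K_v̲` (`InitialThetaDataLocalTorsionProofs`). Silverman, *AEC*, III.6.4, VIII.§1.
Nothing here takes a side on [IUTchIII] Cor. 3.12.

## References

* [SilvermanAEC2009] J. H. Silverman, *The Arithmetic of Elliptic Curves*, 2nd ed., Cor. III.6.4 (b),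
  VIII.§1.
* [Mochizuki2012] S. Mochizuki, *Inter-universal Teichmüller theory I*, Example 3.2 (iv) p. 71
  (consumer locus only).
-/

noncomputable section

open scoped Classical

namespace Literature.NumberTheory.EllipticCurves

open WeierstrassCurve Field

universe u

variable {K : Type u} [Field K] (W : WeierstrassCurve K) (E : Type u) [Field E] [Algebra K E]

/-- **Galois-trivial `m`-torsion is Galois-trivial over every `K`-field.** If `Γ_K` fixes every
`m`-torsion point of `E(K̄)` (`m ≠ 0`, `char K = 0`), then `Γ_{E'}` fixes every `m`-torsion point of
`E(K̄_{E'})`: such a point is `ι_* P` with `P ∈ E(K̄)[m]` for the chosen embedding `ι = closureEmb E'`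
(`exists_pointsMapOfEmb_eq_of_nsmul_eq_zero`) and `τ • ι_* P = ι_* (τ|_{K̄} • P) = ι_* P` (`pointsMapOfEmb_smul`).
[cite: SilvermanAEC2009, Cor. III.6.4 (b)] -/
theorem smul_eq_of_nsmul_eq_zero_of_forall_geomPoints [CharZero K] [W.IsElliptic] {m : ℕ}
    (hm : m ≠ 0) (h : ∀ (σ : absoluteGaloisGroup K) (P : geomPoints W), m • P = 0 → σ • P = P)
    (τ : absoluteGaloisGroup E) {Q : localPoints W E} (hQ : m • Q = 0) : τ • Q = Q := by
  obtain ⟨P, hP, rfl⟩ := exists_pointsMapOfEmb_eq_of_nsmul_eq_zero W (closureEmb (K := K) E) hm hQ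
  rw [← pointsMapOfEmb_smul, h _ P hP]

/-- The same on the torsion subgroup: if `Γ_K` acts trivially on `E(K̄)[m]`, then `Γ_{E'}` acts
trivially on `E(K̄_{E'})[m]` (`m ≠ 0`, `char K = 0`). [cite: SilvermanAEC2009, Cor. III.6.4 (b)] -/
theorem smul_torsionBy_localPoints_eq [CharZero K] [W.IsElliptic] {m : ℕ} (hm : m ≠ 0)
    (h : ∀ (σ : absoluteGaloisGroup K) (P : geomTorsion W (m : ℤ)), σ • P = P)
    (τ : absoluteGaloisGroup E) (Q : AddSubgroup.torsionBy (localPoints W E) (m : ℤ)) :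
    τ • Q = Q := by
  apply Subtype.ext
  rw [AddSubgroup.torsionBy.coe_smul]
  refine smul_eq_of_nsmul_eq_zero_of_forall_geomPoints W E hm (fun σ P hP => ?_) τ ?_
  · have hmem : P ∈ geomTorsion W (m : ℤ) :=
      (Submodule.mem_torsionBy_iff _ _).mpr (by rw [natCast_zsmul, hP])
    exact congrArg Subtype.val (h σ ⟨P, hmem⟩)
  · rw [← natCast_zsmul]
    exact (Submodule.mem_torsionBy_iff _ _).mp Q.2

end Literature.NumberTheory.EllipticCurves

end
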